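import Summits.BirchSwinnertonDyer.BirchSwinnertonDyer.Theorems.PrintCFramBottomClassIndexLawFiveLeLevelDictionaryLine
import Summits.BirchSwinnertonDyer.Rank1Residual.X11b.KummerRelaxedStructures
import Summits.BirchSwinnertonDyer.Rank1Residual.X11b.MaxUnramifiedRestriction
import Literature.NumberTheory.GaloisRepresentations.DecompositionGroupOfCompletion
import Literature.NumberTheory.EllipticCurves.LocalTorsionCohomologyCoprime
import Literature.NumberTheory.EllipticCurves.CasselsTateSelmerKolyvaginValue
import Literature.NumberTheory.EllipticCurves.ArchimedeanLocalConditionTorsion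
import Literature.NumberTheory.EllipticCurves.StrictSelmerTorsionLevelUniformBound
import Literature.NumberTheory.EllipticCurves.PeriodIndexCassels
import HarnessLib

/-!
# Route `PrintCFram`, crux C2 `BottomClassIndexLawFiveLe` (stmt-BirchSwinnertonDyer-20372), line
# `eisenstein-resource-bdp-line` (LEAD g10, report §2(d)(β) / §4 `classFactor_imp_levelPos_or_sha`):
# **THE LEVEL DICTIONARY (β), GALOIS HALF** — an everywhere-unramified non-zero class of the SUB line is
# a Selmer class of `W[m]`; it is either visible in `Ш(W/K)` or it is the Kummer class of a rational point,
# which then has LEVEL ≥ 1 at the place above `p`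
# (cell `bsd-print-cfram`, width seat `bsd-line-cfram-p1-w4` g8; helper `--supports` 20372; 0 defs, 0 facts,
# 0 sorry)

HONEST FRAMING. Nothing about BSD is proved here, and nothing of any stub. This is the Galois half of
LEAD g10's (β) («CLASS FACTOR NON-UNIT ⟹ LEVEL ≥ 1 OR `Ш[p] ≠ 0`»); the class-group half (Mazur–Wiles ⟹ a
non-zero everywhere-unramified class for the sub character) is w6 g2's `…HerbrandOddIrregularWitness`. Input
here: a continuous crossed homomorphism `w : Γ_K → Φ.Sub` (Φ ≤ `W[m]` a stable line) with NON-ZERO class,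
a coboundary on the inertia group `I_𝔓` of every prime `𝔓` of `\bar ℤ_K`. Steps:

* §1 (cocycle algebra) `forall_eq_smul_sub_of_normal` — a crossed homomorphism principal on a NORMAL
  subgroup `I` (along `θ : H → G`) with `S^I = 0` is principal on all of `H`, with the same vector;
  `oneCocycleClass_push_ne_zero` — `[ι ∘ w] ≠ 0` if `[w] ≠ 0`, `ι` injective with `ker π = im ι` and
  `Q^G = 0` (`H⁰(G, Q) = 0 ⟹ H¹(G, S) ↪ H¹(G, M)`).
* §2 (local conditions of the pushed class `c = [Φ.incl ∘ w] ∈ H¹(K, W[m])`)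
  `mem_torsionLocalKer_of_coboundaryOn_decomp` — principal on `D_v` ⟹ `c ∈ torsionLocalKer W K_v m`;
  `incl_mem_torsionLocalKer_of_noInvariants` — at `v` with `Φ.Sub^{I_𝔓} = 0` (the sub character
  ramified, e.g. `v ∣ p`): `c ∈ torsionLocalKer W K_v m` (§1 on `Γ_{K_v} ⊵ I_{K_v}`);
  `mem_selmerLocalKer_of_coboundaryOn_inertia_of_good` — at a GOOD `v ∤ p`, `m = p^k`: unramified ⟹
  the Kummer condition (X11b `KummerPT.kummerSelmerStructure_inr_eq_unramifiedSubgroup`, Milne I 3.8, +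
  `LocBridge.mem_unramifiedSubgroup_one_iff_exists`) ⟹ `c ∈ selmerLocalKer W K_v (p^k)`;
  `mem_selmerLocalKer_infinitePlace_of_odd` — at the infinite places, for odd `m`, nothing to check.
* §3 **`levelPos_or_sha_of_unramified_sub_class`** — (β, Galois half). `K` a number field, `W/K`
  elliptic, `p` an odd prime, `Φ ≤ W[p]` a stable line; `w : Γ_K → Φ.Sub` with non-zero class, a
  coboundary on every `I_𝔓`; ASSUME `Φ.Quot^{Γ_K} = 0` (some element moves the quotient line),
  `Φ.Sub^{I_𝔓} = 0` for `𝔓 ∣ v` at the places `v ∣ p`, and `W(K_v)[p] = 0` at the bad places `v ∤ p`.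
  THEN either `Ш(W/K)` contains a NON-ZERO class killed by `p`, or there is `P' ∈ W(K)`, NOT `p`-divisible
  in `W(K)`, which is `p`-divisible in `W(K_v)` at every place `v ∣ p` (LEVEL ≥ 1) — and whose Kummer class
  is `[Φ.incl ∘ w]`.

THEOREMS ONLY; no definition, no named fact, no `sorry`. BSD is not proved by any of this; no summit statement
is proved by this seat. References: [SilvermanAEC2009] VIII.§2, X.§4 (Thm. 4.2, Cor. 4.4); [MilneADT2006]
I.§2, I.3.8, I.§6; [SerreGaloisCohomology1997] I.§2.6 (b), I.§5.1, II.§1.1; [GreenbergLNM1716] §3;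
the LEAD g10 report §2(d), §4.
-/

set_option autoImplicit false
-- `…BirchSwinnertonDyer.BirchSwinnertonDyer.Theorems…` is the problem's mandated namespace (D-0017).
set_option linter.dupNamespace false

noncomputable section

open scoped Classical Pointwise

namespace Summit.BirchSwinnertonDyer.BirchSwinnertonDyer.Theorems.PrintCFram.LevelDictionary

open NumberField IsDedekindDomain Field WeierstrassCurve
open Literature.NumberTheory.EllipticCurves Literature.NumberTheory.GaloisRepresentations
  Literature.NumberTheory.EllipticCurves.GreenbergSelmer
open Literature.NumberTheory.GaloisRepresentations.DiscreteGaloisModule (unramifiedSubgroup)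
open Summit.BirchSwinnertonDyer.Rank1Residual
open Summit.BirchSwinnertonDyer.Rank1Residual.X11b

/-! ## §1 Cocycle algebra -/

section Normal

variable {G H : Type} [Group G] [TopologicalSpace G] [Group H]
variable {F : Type} [FunLike F H G] [MonoidHomClass F H G]
variable {S : Type} [AddCommGroup S] [DistribMulAction G S] [TopologicalSpace S] [DiscreteTopology S]

/-- **Principal on a normal subgroup with no invariants ⟹ principal.** Let `θ : H → G` be a homomorphism,
`I ⊴ H` a normal subgroup such that `S` has no non-zero vector fixed by `θ(I)`, and `z : G → S` a continuous
crossed homomorphism with `z(θ i) = θ i • s − s` for `i ∈ I`. Then `z(θ h) = θ h • s − s` for EVERY `h ∈ H`: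
`z' = z ∘ θ − ∂s` vanishes on `I`, and for `i ∈ I`, `h ∈ H` the identity `i h = h (h⁻¹ i h)` gives
`θ i • z'(h) = z'(h)`, so `z'(h) ∈ S^{I} = 0`. (Inflation–restriction: `H¹(H/I, S^I) = 0`.)
[cite: SerreGaloisCohomology1997, I.§2.6 (b)] -/
theorem forall_eq_smul_sub_of_normal (θ : F) (I : Subgroup H) [I.Normal]
    (hS : ∀ s : S, (∀ i ∈ I, θ i • s = s) → s = 0)
    (z : contOneCocycles (discreteTopRep G S)) {s : S} (hs : ∀ i ∈ I, z.1 (θ i) = θ i • s - s)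
    (h : H) : z.1 (θ h) = θ h • s - s := by
  have key : ∀ i ∈ I, θ i • (z.1 (θ h) - (θ h • s - s)) = z.1 (θ h) - (θ h • s - s) := by
    intro i hi
    have hi' : h⁻¹ * i * h ∈ I := by
      have := (inferInstance : I.Normal).conj_mem i hi h⁻¹
      rwa [inv_inv] at this
    have h1 := cocycle_mul' z (θ i) (θ h)
    have h2 := cocycle_mul' z (θ h) (θ (h⁻¹ * i * h))
    have heq : θ i * θ h = θ h * θ (h⁻¹ * i * h) := by
      rw [← map_mul, ← map_mul]
      congr 1
      group
    rw [heq] at h1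
    have e := h1.symm.trans h2
    rw [hs i hi, hs _ hi'] at e
    have hθ : θ (h⁻¹ * i * h) = (θ h)⁻¹ * θ i * θ h := by rw [map_mul, map_mul, map_inv]
    have hprod : θ h * ((θ h)⁻¹ * θ i * θ h) = θ i * θ h := by group
    rw [hθ, smul_sub, smul_smul, hprod] at e
    -- `e : θ i • s - s + θ i • z (θ h) = z (θ h) + ((θ i * θ h) • s - θ h • s)`
    have e2 : θ i • z.1 (θ h) = z.1 (θ h) + ((θ i * θ h) • s - θ h • s) - (θ i • s - s) := by
      rw [← e]; abel
    rw [smul_sub, smul_sub, smul_smul, e2]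
    abel
  exact sub_eq_zero.1 (hS _ key)

end Normal

section Push

variable {G : Type} [Group G]
variable {S M Q : Type} [AddCommGroup S] [AddCommGroup M] [AddCommGroup Q]
  [DistribMulAction G S] [DistribMulAction G M] [DistribMulAction G Q]

/-- **`H⁰(G, Q) = 0 ⟹ H¹(G, S) → H¹(G, M)` is injective, on cocycles.** If `ι : S → M` is injective and
equivariant with `ker π = im ι` for an equivariant `π : M → Q`, `Q` has no non-zero `G`-invariant, and the
push-forward `ι ∘ w` of a map `w : G → S` is principal (`ι (w g) = g m₀ − m₀`), then `w` is principal: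
`π m₀ ∈ Q^G = 0`, so `m₀ = ι s₀` and `w = ∂s₀`. [cite: SerreGaloisCohomology1997, I.§2.6 (b) and I.§5.1] -/
theorem exists_eq_smul_sub_of_push_principal (ι : S →+ M) (π : M →+ Q)
    (hι : ∀ (g : G) (s : S), ι (g • s) = g • ι s) (hπ : ∀ (g : G) (m : M), π (g • m) = g • π m)
    (hιinj : Function.Injective ι) (hπι : ∀ s, π (ι s) = 0) (hker : ∀ m, π m = 0 → ∃ s, ι s = m)
    (hQ : ∀ q : Q, (∀ g : G, g • q = q) → q = 0)
    (w : G → S) {m₀ : M} (hw : ∀ g, ι (w g) = g • m₀ - m₀) :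
    ∃ s₀ : S, ∀ g, w g = g • s₀ - s₀ := by
  have hπm : ∀ g : G, g • π m₀ = π m₀ := fun g ↦ by
    have h := congrArg π (hw g)
    rw [hπι, map_sub, hπ] at h
    exact (sub_eq_zero.1 h.symm)
  obtain ⟨s₀, hs₀⟩ := hker m₀ (hQ _ hπm)
  refine ⟨s₀, fun g ↦ hιinj ?_⟩
  rw [hw g, ← hs₀, map_sub, hι]

end Push

/-! ## §2 The local conditions of the pushed class -/

section Local

variable {K : Type} [Field K] [NumberField K] (W : WeierstrassCurve K) [W.IsElliptic]

omit [W.IsElliptic] in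
/-- **Principal on the decomposition group ⟹ local kernel** (converse of
`coboundaryOn_decomp_of_mem_torsionLocalKer`): if a continuous crossed homomorphism `φ : Γ_K → W[n]` satisfies
`φ g = g t − t` on `D_v = GreenbergSelmer.decomp v`, its class lies in
`torsionLocalKer W K_v n = ker (H¹(K, W[n]) → H¹(K_v, W[n]))`. [cite: SerreGaloisCohomology1997, I.§5.1 and II.§1.1] -/
theorem mem_torsionLocalKer_of_coboundaryOn_decomp {n : ℤ} (v : HeightOneSpectrum (𝓞 K))
    (φ : contOneCocycles (discreteTopRep (absoluteGaloisGroup K) (geomTorsion W n)))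
    {t : geomTorsion W n} (ht : ∀ g ∈ decomp v, φ.1 g = g • t - t) :
    oneCocycleClass _ φ ∈ W.torsionLocalKer (v.adicCompletion K) n := by
  change oneCocycleClass _ φ ∈
    resKer (resGal (K := K) (v.adicCompletion K)) (torsionPointsMap W (v.adicCompletion K) n)
      (torsionPointsMap_smul W (v.adicCompletion K) n)
  rw [oneCocycleClass_mem_resKer_iff]
  refine ⟨torsionPointsMap W (v.adicCompletion K) n t, fun σ ↦ ?_⟩
  have hmem : resGal (K := K) (v.adicCompletion K) σ ∈ decomp v := by
    rw [resGal_eq_absGaloisRestrict]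
    exact ⟨σ, rfl⟩
  rw [ht _ hmem, map_sub, torsionPointsMap_smul]

omit [W.IsElliptic] in
/-- **At a place where the sub line is ramified, an everywhere-unramified class of `Φ.Sub` is LOCALLY TRIVIAL
in `H¹(K_v, W[n])`.** If `Φ.Sub` has no non-zero vector fixed by the inertia group `I_𝔓₀` of the prime
`𝔓₀ = adicCompletionPrime K v` (the prime cut out by the chosen embedding `K̄ → K̄_v`), and `w : Γ_K → Φ.Sub` is
principal on `I_𝔓₀`, then the push-forward `Φ.incl ∘ w` has class in `torsionLocalKer W K_v n`: pulled back to
`Γ_{K_v} ⊵ I_{K_v}` (`inertia_adicCompletionPrime_eq_map_absInertia`), `w` is principal on the normal subgroup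
`I_{K_v}` with `Φ.Sub^{I_{K_v}} = 0`, hence principal on `Γ_{K_v}` (`forall_eq_smul_sub_of_normal`).
[cite: SerreGaloisCohomology1997, I.§2.6 (b) and II.§1.1] [cite: NeukirchANT1999, Ch. II §9 Prop. (9.6)] -/
theorem incl_mem_torsionLocalKer_of_noInvariants {n : ℤ} (v : HeightOneSpectrum (𝓞 K))
    (Φ : X2.ResidualDevissageModules.StableSubgroup (absoluteGaloisGroup K) (geomTorsion W n))
    (hS : ∀ s : Φ.Sub, (∀ g ∈ (adicCompletionPrime K v).inertia (absoluteGaloisGroup K), g • s = s) → s = 0)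
    (w : contOneCocycles (discreteTopRep (absoluteGaloisGroup K) Φ.Sub))
    {s : Φ.Sub} (hs : ∀ g ∈ (adicCompletionPrime K v).inertia (absoluteGaloisGroup K), w.1 g = g • s - s)
    (z : contOneCocycles (discreteTopRep (absoluteGaloisGroup K) (geomTorsion W n)))
    (hz : ∀ g, z.1 g = Φ.incl (w.1 g)) :
    oneCocycleClass _ z ∈ W.torsionLocalKer (v.adicCompletion K) n := by
  have hIθ : ∀ i ∈ absInertia (v.adicCompletion K),
      absGaloisRestrict K (v.adicCompletion K) i ∈
        (adicCompletionPrime K v).inertia (absoluteGaloisGroup K) := fun i hi ↦ by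
    rw [inertia_adicCompletionPrime_eq_map_absInertia]
    exact Subgroup.mem_map.mpr ⟨i, hi, rfl⟩
  have hSθ : ∀ s : Φ.Sub, (∀ i ∈ absInertia (v.adicCompletion K),
      absGaloisRestrict K (v.adicCompletion K) i • s = s) → s = 0 := by
    intro s' hs'
    refine hS s' fun g hg ↦ ?_
    rw [inertia_adicCompletionPrime_eq_map_absInertia] at hg
    obtain ⟨i, hi, rfl⟩ := Subgroup.mem_map.mp hg
    exact hs' i hi
  have hsθ : ∀ i ∈ absInertia (v.adicCompletion K),
      w.1 (absGaloisRestrict K (v.adicCompletion K) i) = absGaloisRestrict K (v.adicCompletion K) i • s - s :=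
    fun i hi ↦ hs _ (hIθ i hi)
  have hall := forall_eq_smul_sub_of_normal (absGaloisRestrict K (v.adicCompletion K))
    (absInertia (v.adicCompletion K)) hSθ w hsθ
  refine mem_torsionLocalKer_of_coboundaryOn_decomp W v z (t := Φ.incl s) fun g hg ↦ ?_
  obtain ⟨σ, rfl⟩ := (mem_decomp_iff v g).1 hg
  rw [hz, hall σ, map_sub, X2.ResidualDevissageModules.StableSubgroup.incl_smul]

/-- **At a GOOD place `v ∤ p`, an unramified class of `H¹(K, W[p^k])` satisfies the Selmer local condition**
(Silverman X.4.4 / Milne I.3.8: the local Kummer condition at a good `v ∤ p` IS `H¹_ur(K_v, W[p^k])`, the tree's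
X11b `KummerPT.kummerSelmerStructure_inr_eq_unramifiedSubgroup`). If `φ : Γ_K → W[p^k]` is principal on the
inertia group of `𝔓₀ = adicCompletionPrime K v`, then `[φ] ∈ selmerLocalKer W K_v (p^k)`.
[cite: SilvermanAEC2009, Cor. X.4.4] [cite: MilneADT2006, Ch. I Prop. 3.8] -/
theorem mem_selmerLocalKer_of_coboundaryOn_inertia_of_good (p k : ℕ) [Fact p.Prime] {n : ℤ}
    (hn : ((p ^ k : ℕ) : ℤ) = n)
    {v : HeightOneSpectrum (𝓞 K)} (hpv : ((p : ℕ) : 𝓞 K) ∉ v.asIdeal) (hv : W.HasGoodReductionAt v)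
    (φ : contOneCocycles (discreteTopRep (absoluteGaloisGroup K) (geomTorsion W n)))
    {t : geomTorsion W n}
    (ht : ∀ g ∈ (adicCompletionPrime K v).inertia (absoluteGaloisGroup K), φ.1 g = g • t - t) :
    oneCocycleClass _ φ ∈ selmerLocalKer W (v.adicCompletion K) n := by
  subst hn
  apply mem_selmerLocalKer_of_mem_kummerLocalConditionAt_res
  have hKS : W.kummerLocalConditionAt ((p ^ k : ℕ) : ℤ) (v.adicCompletion K) =
      unramifiedSubgroup (GaloisRep.toLocal v (W.torsionGaloisModule ((p ^ k : ℕ) : ℤ))) 1 := by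
    rw [← KummerPT.kummerSelmerStructure_inr_eq_unramifiedSubgroup W p k hpv hv,
      WeierstrassCurve.kummerSelmerStructure_apply]
    rfl
  rw [hKS, res_torsionGaloisModule_oneCocycleClass]
  refine (LocBridge.mem_unramifiedSubgroup_one_iff_exists
    (GaloisRep.toLocal v (W.torsionGaloisModule ((p ^ k : ℕ) : ℤ))) _).mpr ⟨t, fun τ hτ ↦ ?_⟩
  rw [contOneCocycles.pullback_apply]
  have hmem : absGaloisRestrict K (v.adicCompletion K) τ ∈
      (adicCompletionPrime K v).inertia (absoluteGaloisGroup K) := by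
    rw [inertia_adicCompletionPrime_eq_map_absInertia]
    exact Subgroup.mem_map.mpr ⟨τ, hτ, rfl⟩
  change φ.1 (absGaloisRestrict K (v.adicCompletion K) τ) = _
  rw [ht _ hmem]
  rfl

omit [W.IsElliptic] in
/-- **At the infinite places, for odd `m`, every class of `H¹(K, W[m])` satisfies the Selmer local condition**:
`2 • c` does (`two_nsmul_mem_selmerLocalKer_infinitePlace`) and `m • c = 0`, so `c = (k+1) • (2 • c)` for
`m = 2k + 1`. [cite: SerreGaloisCohomology1997, I.§2.4 Cor. to Prop. 9] -/
theorem mem_selmerLocalKer_infinitePlace_of_odd {m : ℕ} (hm : Odd m) (w : InfinitePlace K)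
    (c : galH1Torsion W (m : ℤ)) : c ∈ selmerLocalKer W w.Completion (m : ℤ) := by
  obtain ⟨k, hk⟩ := hm
  have h2 := two_nsmul_mem_selmerLocalKer_infinitePlace W (m : ℤ) w c
  have hm0 : m • c = 0 := nsmul_galH1Torsion_natCast_eq_zero W m c
  have hc : c = (k + 1) • (2 • c) := by
    rw [← mul_nsmul', show (k + 1) * 2 = m + 1 by omega, add_nsmul, hm0, one_nsmul, zero_add]
  rw [hc]
  exact AddSubgroup.nsmul_mem _ h2 _

end Local

/-! ## §3 (β, Galois half): LEVEL ≥ 1 or a visible element of `Ш` -/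

section Beta

variable {K : Type} [Field K] [NumberField K] (W : WeierstrassCurve K) [W.IsElliptic]

/-- **(β, GALOIS HALF) AN EVERYWHERE-UNRAMIFIED CLASS OF THE SUB LINE GIVES LEVEL ≥ 1 OR `Ш[p] ≠ 0`.**
`K` a number field, `W/K` elliptic, `p` an odd prime, `Φ ≤ W[p]` a `Γ_K`-stable subgroup (sub `Φ.Sub`,
quotient `Φ.Quot`), `w : Γ_K → Φ.Sub` a continuous crossed homomorphism with NON-ZERO class which is a
coboundary on the inertia group `I_𝔓` of every prime `𝔓` of `\bar ℤ_K`. ASSUME: `Φ.Quot` has no non-zero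
`Γ_K`-invariant; at every place `v ∣ p`, `Φ.Sub` has no non-zero vector fixed by the inertia group of the
prime `adicCompletionPrime K v` (the sub character is ramified at `p`); at every BAD place `v ∤ p`,
`W(K_v)[p] = 0`. THEN: EITHER `Ш(W/K)` contains a NON-ZERO class killed by `p`, OR there is a point
`P' ∈ W(K)`, NOT `p`-divisible in `W(K)`, which is `p`-divisible in `W(K_v)` at EVERY place `v ∣ p`
(LEVEL ≥ 1). PROOF: the push-forward `ξ = [Φ.incl ∘ w] ∈ H¹(K, W[p])` is non-zero (`H⁰(Γ_K, Φ.Quot) = 0`),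
locally trivial at `v ∣ p` (§2), Selmer at the bad `v ∤ p` (`H¹(K_v, W[p]) = 0`), at the good `v ∤ p`
(unramified = Kummer, X11b) and at infinity (`p` odd); its image in `H¹(K, W)` lies in `Ш` (Silverman
X.4.2(a)); if that image vanishes, `ξ = δ(P')` is a Kummer class (exactness of the Kummer sequence), `P'` is
not `p`-divisible (`ξ ≠ 0`) and is `p`-divisible in `W(K_v)` for `v ∣ p` (local exactness). This is the
Galois half of LEAD g10's `classFactor_imp_levelPos_or_sha`; the class-group half (an unramified `w` from
`p ∣ B_{1,ψ⁻¹}`, Mazur–Wiles) is w6 g2's. [cite: SilvermanAEC2009, Thm. X.4.2(a) and VIII.§2]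
[cite: MilneADT2006, Ch. I Prop. 3.8 and §6] [cite: GreenbergLNM1716, §3 (PDF p. 86)] -/
theorem levelPos_or_sha_of_unramified_sub_class (p : ℕ) [hp : Fact p.Prime] (hp2 : p ≠ 2)
    (Φ : X2.ResidualDevissageModules.StableSubgroup (absoluteGaloisGroup K) (geomTorsion W (p : ℤ)))
    (hQΓ : ∀ q : Φ.Quot, (∀ g : absoluteGaloisGroup K, g • q = q) → q = 0)
    (hSp : ∀ v : HeightOneSpectrum (𝓞 K), ((p : ℕ) : 𝓞 K) ∈ v.asIdeal →
      ∀ s : Φ.Sub, (∀ g ∈ (adicCompletionPrime K v).inertia (absoluteGaloisGroup K), g • s = s) → s = 0)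
    (hbad : ∀ v : HeightOneSpectrum (𝓞 K), ¬ W.HasGoodReductionAt v → ((p : ℕ) : 𝓞 K) ∉ v.asIdeal →
      ∀ P : (W.baseChange (v.adicCompletion K)).toAffine.Point, p • P = 0 → P = 0)
    (w : contOneCocycles (discreteTopRep (absoluteGaloisGroup K) Φ.Sub)) (hw : oneCocycleClass _ w ≠ 0)
    (hwI : ∀ (v : HeightOneSpectrum (𝓞 K)) (𝔓 : Ideal (absIntegers (𝓞 K) K)), 𝔓 ∈ v.primesAbove →
      ∃ s : Φ.Sub, ∀ g ∈ 𝔓.inertia (absoluteGaloisGroup K), w.1 g = g • s - s) :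
    (∃ c ∈ W.sha, c ≠ 0 ∧ p • c = 0) ∨
    ∃ P' : W.toAffine.Point, (∀ R : W.toAffine.Point, (p : ℤ) • R ≠ P') ∧
      ∀ v : HeightOneSpectrum (𝓞 K), ((p : ℕ) : 𝓞 K) ∈ v.asIdeal →
        ∃ R : (W.baseChange (v.adicCompletion K)).toAffine.Point,
          Affine.Point.baseChange (W' := W) K (v.adicCompletion K) P' = (p : ℤ) • R := by
  have hp0 : ((p : ℕ) : ℤ) ≠ 0 := by exact_mod_cast hp.out.ne_zero
  -- the pushed cocycle `z = Φ.incl ∘ w` and its class `ξ`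
  set z : contOneCocycles (discreteTopRep (absoluteGaloisGroup K) (geomTorsion W (p : ℤ))) :=
    contOneCocycles.pullback (ContinuousMonoidHom.id _)
      (resHomOfEquivariant (ContinuousMonoidHom.id _) Φ.incl Φ.incl_smul) w with hzdef
  have hz : ∀ g, z.1 g = Φ.incl (w.1 g) := fun g ↦ rfl
  set ξ : galH1Torsion W (p : ℤ) := oneCocycleClass _ z with hξ
  -- `ξ ≠ 0` (`H⁰(Γ_K, Φ.Quot) = 0`)
  have hξne : ξ ≠ 0 := by
    intro h0
    obtain ⟨m₀, hm₀⟩ := (oneCocycleClass_eq_zero_iff _ z).1 h0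
    have hker : ∀ m : geomTorsion W (p : ℤ), Φ.proj m = 0 → ∃ s : Φ.Sub, Φ.incl s = m := fun m hm ↦ by
      obtain ⟨s, hs⟩ := Φ.mem_range_incl_of_proj_eq_zero m hm
      exact ⟨s, hs⟩
    obtain ⟨s₀, hs₀⟩ := exists_eq_smul_sub_of_push_principal Φ.incl Φ.proj Φ.incl_smul Φ.proj_smul
      Φ.incl_injective Φ.proj_incl hker hQΓ w.1 (m₀ := m₀) (fun g ↦ by rw [← hz]; exact hm₀ g)
    exact hw ((oneCocycleClass_eq_zero_iff _ w).2 ⟨s₀, hs₀⟩)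
  -- local triviality at the places above `p`
  have hlocp : ∀ v : HeightOneSpectrum (𝓞 K), ((p : ℕ) : 𝓞 K) ∈ v.asIdeal →
      ξ ∈ W.torsionLocalKer (v.adicCompletion K) (p : ℤ) := by
    intro v hv
    obtain ⟨s, hs⟩ := hwI v _ (adicCompletionPrime_mem_primesAbove K v)
    exact incl_mem_torsionLocalKer_of_noInvariants W v Φ (hSp v hv) w hs z hz
  -- `ξ` is a Selmer class
  have hsel : ξ ∈ W.selmerGroup (p : ℤ) := by
    rw [mem_selmerGroup_iff]
    refine ⟨fun v ↦ ?_, fun w' ↦ mem_selmerLocalKer_infinitePlace_of_odd W (hp.out.odd_of_ne_two hp2) w' ξ⟩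
    by_cases hpv : ((p : ℕ) : 𝓞 K) ∈ v.asIdeal
    · exact W.torsionLocalKer_le_selmerLocalKer (v.adicCompletion K) (p : ℤ) (hlocp v hpv)
    by_cases hgood : W.HasGoodReductionAt v
    · obtain ⟨t, ht⟩ := hwI v _ (adicCompletionPrime_mem_primesAbove K v)
      exact mem_selmerLocalKer_of_coboundaryOn_inertia_of_good W p 1 (by rw [pow_one]) hpv hgood z
        (t := Φ.incl t) fun g hg ↦ by
          rw [hz, ht g hg, map_sub, X2.ResidualDevissageModules.StableSubgroup.incl_smul]
    · haveI : NeZero p := ⟨hp.out.ne_zero⟩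
      exact W.torsionLocalKer_le_selmerLocalKer (v.adicCompletion K) (p : ℤ)
        (W.mem_torsionLocalKer_adicCompletion_of_forall_nsmul_eq_zero (v := v) p hpv (hbad v hgood hpv) ξ)
  have hsha : W.torsionH1ToH1 (p : ℤ) ξ ∈ W.sha := torsionH1ToH1_mem_sha_of_mem_selmerGroup W hp0 hsel
  by_cases hc : W.torsionH1ToH1 (p : ℤ) ξ = 0
  · -- `ξ` is the Kummer class of a rational point
    right
    have hdiv : ∀ P : geomPoints W, ∃ Q : geomPoints W, (p : ℤ) • Q = P := fun P ↦
      (W.baseChange (AlgebraicClosure K)).zsmul_surjective_of_isAlgClosed hp0 P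
    obtain ⟨P', hP'⟩ := mem_range_kummerMapTorsion_of_torsionH1ToH1_eq_zero W (p : ℤ) hdiv ξ hc
    refine ⟨P', fun R hR ↦ hξne ?_, fun v hv ↦ ?_⟩
    · rw [← hP', ← hR, map_zsmul, natCast_zsmul]
      exact nsmul_galH1Torsion_natCast_eq_zero W p _
    · haveI : CharZero (v.adicCompletion K) :=
        charZero_of_injective_algebraMap (algebraMap K (v.adicCompletion K)).injective
      have hres : galoisCohomology.res (W.torsionGaloisModule (p : ℤ)) (v.adicCompletion K) 1
          (kummerMapTorsion W (p : ℤ) hdiv P') = 0 := by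
        rw [hP']
        exact (mem_torsionLocalKer_iff_res_eq_zero (W := W) (E := v.adicCompletion K) hp.out.ne_zero ξ).1
          (hlocp v hv)
      exact exists_baseChange_eq_zsmul_of_res_kummerMapTorsion_eq_zero W hdiv (v.adicCompletion K) P' hres
  · left
    refine ⟨_, hsha, hc, ?_⟩
    rw [← map_nsmul, nsmul_galH1Torsion_natCast_eq_zero W p ξ, map_zero]

end Beta

end Summit.BirchSwinnertonDyer.BirchSwinnertonDyer.Theorems.PrintCFram.LevelDictionary

end
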